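import Literature.Probability.NegativeDependence.NegativeAssociationHierarchy
import HarnessLib

/-!
# CNA ⟹ h-NLC (Pemantle 2000, §2.2; Borcea–Brändén–Liggett, Remark 2.4)

R. Pemantle, *Towards a theory of negative dependence*, J. Math. Phys. 41 (2000) 1371–1390 (held
`paper:arxiv-math_0404095`), §2.2, verbatim (pp. 7–8):

> **Definition 2.3.** Say that the variables `{X_e : e ∈ E}` are jointly negative regression dependent (JNRD) if
> the vectors `⟨X_e : e ∈ A⟩` and `⟨X_e : e ∉ A⟩` are always negative regression dependent. Equivalently, require
> that for any increasing event `H` measurable with respect to `{X_e : e ∈ A}`, `μ(H | x_e : e ∉ A)` is decreasing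
> with respect to the partial order on `{0,1}^{A^c}`.
> Unraveling the definitions, one sees that conditional negative association implies JNRD, since JNRD is simply
> CNA in the special case where one has conditioned on `{X_e : e ∈ A^c} ∖ {f}` and then asks for `X_f` to be
> negatively correlated with `𝟏_H` for any increasing event `H` measurable with respect to `{X_e : e ∈ A}`.
> The negative lattice condition `μ(x ∨ y) μ(x ∧ y) ≤ μ(x) μ(y)` […]
> **Definition 2.4.** Say that `{X_e : e ∈ E}` satisfy the hereditary negative lattice condition (h-NLC) if every
> projection satisfies the negative lattice condition.
> It is easy to see that JNRD implies h-NLC, since h-NLC is the special case where `A` is a singleton.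

J. Borcea, P. Brändén, T. M. Liggett [BorceaBrandenLiggett2007], §2.1 **Remark 2.4**: "As explained in [P], one
has the following subordination relations: CNA ⟹ h-NLC and CNA+ ⟹ Rayleigh/h-NLC+."

## What is proved, and how

**`IsCNA.isNLC`** (CNA ⟹ NLC), **`IsCNA.projectOn`** (CNA passes to projections, since conditioning on retained
coordinates commutes with projecting and NA passes to projections — the tree's `pin_projectOn`,
`isNegAssoc_projectOn`), hence **`IsCNA.isHNLC`** (CNA ⟹ h-NLC) and **`BorceaBrandenLiggett_remark_2_4`** (both
arrows of Remark 2.4; the second is the tree's `IsCNAPlus.isHNLCPlus`).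

For NLC at `x, y` (weights with zeros allowed, so the "unraveling" is done with the four corner events at once
rather than one coordinate at a time): put `K = x ∧ y`, `A = x ∖ y`, `B = y ∖ x` and condition on `X ≡ 1` on
`K`, `X ≡ 0` off `x ∨ y` (CNA); the free coordinates are `A ⊔ B`. NA for the pairs (increasing/decreasing
versions, §1) `(𝟏[A ⊆ X], 𝟏[B ⊆ X])`, `(𝟏[A ∩ X = ∅], 𝟏[B ∩ X = ∅])`, `(𝟏[A ⊆ X], 𝟏[B ∩ X = ∅])`,
`(𝟏[A ∩ X = ∅], 𝟏[B ⊆ X])` reads `μ(x∨y) Z ≤ P`, `μ(x∧y) Z ≤ Q`, `μ(x) Z ≥ P'`, `μ(y) Z ≥ Q'` with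
`P Q = P' Q'` (the same four one-factor expectations), whence `μ(x∨y) μ(x∧y) Z² ≤ μ(x) μ(y) Z²`; and `Z = 0`
forces `μ(x ∨ y) = 0`. This is Pemantle's "X_f negatively correlated with `𝟏_H`" for the up-event `H = [A ⊆ X]`
and the down-event `[A ∩ X = ∅]` against both corner events of `B`.

## References

* [Pemantle2000] R. Pemantle, Towards a theory of negative dependence, J. Math. Phys. 41 (2000) — §2.2
  Defs. 2.2–2.4 and the two "unraveling" remarks (CNA ⟹ JNRD ⟹ h-NLC).
* [BorceaBrandenLiggett2007] J. Borcea, P. Brändén, T. M. Liggett, Negative dependence and the geometry of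
  polynomials, J. Amer. Math. Soc. 22 (2009); arXiv:0707.2340 — §2.1 Remark 2.4, Def. 2.7, Def. 2.2 (NLC),
  Fig. 1.
-/

noncomputable section

open Finset
open Literature.Combinatorics.Sahi2008

universe u

namespace Literature.Probability.NegativeDependence

variable {σ : Type u} [Fintype σ] [DecidableEq σ]

/-! ## §1 NA with decreasing test functions -/

section Signs

omit [DecidableEq σ] in
/-- `∫(-F) dμ = -∫F dμ`. [cite: Pemantle2000, §2.2 Def. 2.1] -/
theorem ex_neg' (μ F : Finset σ → ℝ) : ex μ (-F) = -ex μ F := by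
  simp only [ex_def, Pi.neg_apply, mul_neg, Finset.sum_neg_distrib]

/-- NA for two *decreasing* functions on disjoint coordinate sets (apply Def. 2.7 to `-F`, `-G`).
[cite: Pemantle2000, §2.2 Def. 2.1; BorceaBrandenLiggett2007, §2.1 Def. 2.7] -/
theorem IsNegAssoc.antitone_antitone {μ : Finset σ → ℝ} (h : IsNegAssoc μ) {F G : Finset σ → ℝ}
    (hF : Antitone F) (hG : Antitone G) {E₁ E₂ : Finset σ} (hFE : DeterminedBy F E₁) (hGE : DeterminedBy G E₂)
    (hdisj : Disjoint E₁ E₂) : ex μ (F * G) * mass μ ≤ ex μ F * ex μ G := by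
  have key := h (F := -F) (G := -G) (fun S T hST => neg_le_neg (hF hST)) (fun S T hST => neg_le_neg (hG hST))
    (fun S T hST => by rw [Pi.neg_apply, Pi.neg_apply, hFE S T hST])
    (fun S T hST => by rw [Pi.neg_apply, Pi.neg_apply, hGE S T hST]) hdisj
  rwa [neg_mul_neg, ex_neg', ex_neg', neg_mul_neg] at key

/-- An increasing and a decreasing function on disjoint coordinate sets are *positively* correlated under an
NA weight ("`X_f` negatively correlated with `𝟏_H`" ⟺ positively with `𝟏_{H^c}`). [cite: Pemantle2000, §2.2
(after Def. 2.3); BorceaBrandenLiggett2007, §2.1 Def. 2.7] -/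
theorem IsNegAssoc.monotone_antitone {μ : Finset σ → ℝ} (h : IsNegAssoc μ) {F G : Finset σ → ℝ}
    (hF : Monotone F) (hG : Antitone G) {E₁ E₂ : Finset σ} (hFE : DeterminedBy F E₁) (hGE : DeterminedBy G E₂)
    (hdisj : Disjoint E₁ E₂) : ex μ F * ex μ G ≤ ex μ (F * G) * mass μ := by
  have key := h hF (G := -G) (fun S T hST => neg_le_neg (hG hST)) hFE
    (fun S T hST => by rw [Pi.neg_apply, Pi.neg_apply, hGE S T hST]) hdisj
  rw [mul_neg, ex_neg', ex_neg', mul_neg, neg_mul] at key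
  exact neg_le_neg_iff.1 key

/-- The mirror image: decreasing `F`, increasing `G`. [cite: Pemantle2000, §2.2 (after Def. 2.3);
BorceaBrandenLiggett2007, §2.1 Def. 2.7] -/
theorem IsNegAssoc.antitone_monotone {μ : Finset σ → ℝ} (h : IsNegAssoc μ) {F G : Finset σ → ℝ}
    (hF : Antitone F) (hG : Monotone G) {E₁ E₂ : Finset σ} (hFE : DeterminedBy F E₁) (hGE : DeterminedBy G E₂)
    (hdisj : Disjoint E₁ E₂) : ex μ F * ex μ G ≤ ex μ (F * G) * mass μ := by
  rw [mul_comm (ex μ F), mul_comm F]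
  exact h.monotone_antitone hG hF hGE hFE hdisj.symm

end Signs

/-! ## §2 CNA ⟹ NLC: the four corner events -/

section NLC

omit [Fintype σ] in
/-- The corner functions `𝟏[A ⊆ X]` (increasing) and `𝟏[A ∩ X = ∅]` (decreasing) depend on `A`.
[cite: Pemantle2000, §2.2 Def. 2.3 (events measurable with respect to `{X_e : e ∈ A}`)] -/
theorem determinedBy_subset_indicator (A : Finset σ) :
    DeterminedBy (fun V : Finset σ => if A ⊆ V then (1 : ℝ) else 0) A := fun S T hST => by
  have h : A ⊆ S ↔ A ⊆ T := by
    constructor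
    · intro hAS e he
      have : e ∈ T ∩ A := by rw [← hST]; exact Finset.mem_inter.2 ⟨hAS he, he⟩
      exact (Finset.mem_inter.1 this).1
    · intro hAT e he
      have : e ∈ S ∩ A := by rw [hST]; exact Finset.mem_inter.2 ⟨hAT he, he⟩
      exact (Finset.mem_inter.1 this).1
  simp only [h]

omit [Fintype σ] in
/-- See `determinedBy_subset_indicator`. [cite: Pemantle2000, §2.2 Def. 2.3] -/
theorem determinedBy_disjoint_indicator (A : Finset σ) :
    DeterminedBy (fun V : Finset σ => if Disjoint A V then (1 : ℝ) else 0) A := fun S T hST => by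
  have h : Disjoint A S ↔ Disjoint A T := by
    rw [Finset.disjoint_iff_inter_eq_empty, Finset.disjoint_iff_inter_eq_empty, Finset.inter_comm A S,
      Finset.inter_comm A T, hST]
  simp only [h]

omit [Fintype σ] in
/-- `𝟏[A ⊆ X]` is increasing. [cite: Pemantle2000, §2.2 Def. 2.3] -/
theorem monotone_subset_indicator (A : Finset σ) :
    Monotone (fun V : Finset σ => if A ⊆ V then (1 : ℝ) else 0) := fun S T hST => by
  dsimp only
  by_cases h1 : A ⊆ S
  · rw [if_pos h1, if_pos (h1.trans hST)]
  · rw [if_neg h1]; split_ifs <;> norm_num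

omit [Fintype σ] in
/-- `𝟏[A ∩ X = ∅]` is decreasing. [cite: Pemantle2000, §2.2 Def. 2.3] -/
theorem antitone_disjoint_indicator (A : Finset σ) :
    Antitone (fun V : Finset σ => if Disjoint A V then (1 : ℝ) else 0) := fun S T hST => by
  dsimp only
  by_cases h1 : Disjoint A T
  · rw [if_pos h1, if_pos (h1.mono_right hST)]
  · rw [if_neg h1]; split_ifs <;> norm_num

/-- **CNA ⟹ NLC** (Pemantle: CNA ⟹ JNRD ⟹ NLC; BBL Remark 2.4), for nonnegative weights with zeros allowed.
[cite: Pemantle2000, §2.2 (CNA ⟹ JNRD, JNRD ⟹ h-NLC); BorceaBrandenLiggett2007, §2.1 Remark 2.4] -/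
theorem IsCNA.isNLC {μ : Finset σ → ℝ} (hμ : IsCNA μ) (h0 : ∀ S, 0 ≤ μ S) : IsNLC μ := by
  intro x y
  set K : Finset σ := x ∩ y with hK
  set A : Finset σ := x \ y with hA
  set B : Finset σ := y \ x with hB
  set ν := pin K (x ∪ y)ᶜ μ with hν
  have hν0 : ∀ V, 0 ≤ ν V := pin_nonneg h0 _ _
  have hνapp : ∀ V, ν V = if K ⊆ V ∧ V ⊆ x ∪ y then μ V else 0 := by
    intro V
    rw [hν, pin_apply]
    by_cases h1 : K ⊆ V ∧ V ⊆ x ∪ y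
    · rw [if_pos h1, if_pos ⟨h1.1, Finset.disjoint_left.2 fun e he heV => (Finset.mem_compl.1 he) (h1.2 heV)⟩]
    · rw [if_neg h1, if_neg]
      rintro ⟨hKV, hD⟩
      exact h1 ⟨hKV, fun e heV => by_contra fun he => Finset.disjoint_left.1 hD (Finset.mem_compl.2 he) heV⟩
  -- set algebra: `x = K ⊔ A`, `y = K ⊔ B`, `x ∪ y = K ⊔ A ⊔ B`
  have hxK : ∀ e, e ∈ x → e ∈ A ∨ e ∈ K := fun e hex => by
    by_cases hey : e ∈ y
    · exact Or.inr (Finset.mem_inter.2 ⟨hex, hey⟩)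
    · exact Or.inl (Finset.mem_sdiff.2 ⟨hex, hey⟩)
  have hyK : ∀ e, e ∈ y → e ∈ B ∨ e ∈ K := fun e hey => by
    by_cases hex : e ∈ x
    · exact Or.inr (Finset.mem_inter.2 ⟨hex, hey⟩)
    · exact Or.inl (Finset.mem_sdiff.2 ⟨hey, hex⟩)
  have hAB : Disjoint A B := Finset.disjoint_left.2 fun e heA heB =>
    (Finset.mem_sdiff.1 heA).2 (Finset.mem_sdiff.1 heB).1
  -- one-set expectations under `ν`
  have exSingle : ∀ (f : Finset σ → ℝ) (W : Finset σ), K ⊆ W → W ⊆ x ∪ y → f W = 1 →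
      (∀ V, K ⊆ V → V ⊆ x ∪ y → V ≠ W → f V = 0) → ex ν f = μ W := by
    intro f W hKW hW hfW hf0
    rw [ex_def, Finset.sum_eq_single W (fun V _ hVW => ?_) (fun h => absurd (Finset.mem_univ W) h), hνapp W,
      if_pos ⟨hKW, hW⟩, hfW, mul_one]
    rw [hνapp V]
    split_ifs with h1
    · rw [hf0 V h1.1 h1.2 hVW, mul_zero]
    · rw [zero_mul]
  -- the four corner functions
  set H : Finset σ → ℝ := fun V => if A ⊆ V then 1 else 0 with hH
  set EA : Finset σ → ℝ := fun V => if Disjoint A V then 1 else 0 with hEA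
  set U : Finset σ → ℝ := fun V => if B ⊆ V then 1 else 0 with hU
  set EB : Finset σ → ℝ := fun V => if Disjoint B V then 1 else 0 with hEB
  -- their pairwise products pin the set down
  have e1 : ex ν (H * U) = μ (x ∪ y) := by
    refine exSingle _ _ (Finset.inter_subset_left.trans Finset.subset_union_left) (subset_refl _)
      (by simp only [Pi.mul_apply, hH, hU]
          rw [if_pos (Finset.sdiff_subset.trans Finset.subset_union_left),
            if_pos (Finset.sdiff_subset.trans Finset.subset_union_right), mul_one]) fun V hKV hV hne => ?_
    simp only [Pi.mul_apply, hH, hU]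
    by_cases h1 : A ⊆ V
    · by_cases h2 : B ⊆ V
      · exfalso; refine hne (Finset.Subset.antisymm hV fun e he => ?_)
        rcases Finset.mem_union.1 he with hex | hey
        · rcases hxK e hex with h | h; exacts [h1 h, hKV h]
        · rcases hyK e hey with h | h; exacts [h2 h, hKV h]
      · rw [if_neg h2, mul_zero]
    · rw [if_neg h1, zero_mul]
  have e2 : ex ν (H * EB) = μ x := by
    refine exSingle _ _ Finset.inter_subset_left Finset.subset_union_left
      (by simp only [Pi.mul_apply, hH, hEB]
          rw [if_pos Finset.sdiff_subset, if_pos Finset.sdiff_disjoint, mul_one])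
      fun V hKV hV hne => ?_
    simp only [Pi.mul_apply, hH, hEB]
    by_cases h1 : A ⊆ V
    · by_cases h2 : Disjoint B V
      · exfalso; refine hne (Finset.Subset.antisymm (fun e he => ?_) fun e hex => ?_)
        · rcases Finset.mem_union.1 (hV he) with hex | hey
          · exact hex
          · rcases hyK e hey with h | h
            · exact absurd he (Finset.disjoint_left.1 h2 h)
            · exact (Finset.mem_inter.1 h).1
        · rcases hxK e hex with h | h; exacts [h1 h, hKV h]
      · rw [if_neg h2, mul_zero]
    · rw [if_neg h1, zero_mul]
  have e3 : ex ν (EA * U) = μ y := by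
    refine exSingle _ _ Finset.inter_subset_right Finset.subset_union_right
      (by simp only [Pi.mul_apply, hEA, hU]
          rw [if_pos Finset.sdiff_disjoint, if_pos Finset.sdiff_subset, mul_one])
      fun V hKV hV hne => ?_
    simp only [Pi.mul_apply, hEA, hU]
    by_cases h1 : Disjoint A V
    · by_cases h2 : B ⊆ V
      · exfalso; refine hne (Finset.Subset.antisymm (fun e he => ?_) fun e hey => ?_)
        · rcases Finset.mem_union.1 (hV he) with hex | hey
          · rcases hxK e hex with h | h
            · exact absurd he (Finset.disjoint_left.1 h1 h)
            · exact (Finset.mem_inter.1 h).2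
          · exact hey
        · rcases hyK e hey with h | h; exacts [h2 h, hKV h]
      · rw [if_neg h2, mul_zero]
    · rw [if_neg h1, zero_mul]
  have e4 : ex ν (EA * EB) = μ K := by
    refine exSingle _ _ (subset_refl _) (Finset.inter_subset_left.trans Finset.subset_union_left)
      (by simp only [Pi.mul_apply, hEA, hEB]
          rw [if_pos (Finset.disjoint_left.2 fun e heA heK => (Finset.mem_sdiff.1 heA).2 (Finset.mem_inter.1 heK).2),
            if_pos (Finset.disjoint_left.2 fun e heB heK => (Finset.mem_sdiff.1 heB).2 (Finset.mem_inter.1 heK).1),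
            mul_one]) fun V hKV hV hne => ?_
    simp only [Pi.mul_apply, hEA, hEB]
    by_cases h1 : Disjoint A V
    · by_cases h2 : Disjoint B V
      · exfalso; refine hne (Finset.Subset.antisymm (fun e he => ?_) hKV)
        rcases Finset.mem_union.1 (hV he) with hex | hey
        · rcases hxK e hex with h | h
          · exact absurd he (Finset.disjoint_left.1 h1 h)
          · exact h
        · rcases hyK e hey with h | h
          · exact absurd he (Finset.disjoint_left.1 h2 h)
          · exact h
      · rw [if_neg h2, mul_zero]
    · rw [if_neg h1, zero_mul]
  -- the four NA inequalities
  have hNA : IsNegAssoc ν := hμ K (x ∪ y)ᶜ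
  have i1 := hNA (monotone_subset_indicator A) (monotone_subset_indicator B) (determinedBy_subset_indicator A)
    (determinedBy_subset_indicator B) hAB
  have i4 := hNA.antitone_antitone (antitone_disjoint_indicator A) (antitone_disjoint_indicator B)
    (determinedBy_disjoint_indicator A) (determinedBy_disjoint_indicator B) hAB
  have i2 := hNA.monotone_antitone (monotone_subset_indicator A) (antitone_disjoint_indicator B)
    (determinedBy_subset_indicator A) (determinedBy_disjoint_indicator B) hAB
  have i3 := hNA.antitone_monotone (antitone_disjoint_indicator A) (monotone_subset_indicator B)
    (determinedBy_disjoint_indicator A) (determinedBy_subset_indicator B) hAB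
  rw [← hH, ← hU] at i1
  rw [← hEA, ← hEB] at i4
  rw [← hH, ← hEB] at i2
  rw [← hEA, ← hU] at i3
  rw [e1] at i1
  rw [e4] at i4
  rw [e2] at i2
  rw [e3] at i3
  -- nonnegativity of the one-factor expectations
  have hpos : ∀ f : Finset σ → ℝ, (∀ V, 0 ≤ f V) → 0 ≤ ex ν f := fun f hf =>
    Finset.sum_nonneg fun V _ => mul_nonneg (hν0 V) (hf V)
  have ind01 : ∀ (p : Finset σ → Prop) [DecidablePred p] (V : Finset σ), (0 : ℝ) ≤ if p V then 1 else 0 :=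
    fun p _ V => by split_ifs <;> norm_num
  have hH0 : 0 ≤ ex ν H := hpos H fun V => ind01 _ V
  have hU0 : 0 ≤ ex ν U := hpos U fun V => ind01 _ V
  have hEA0 : 0 ≤ ex ν EA := hpos EA fun V => ind01 _ V
  have hEB0 : 0 ≤ ex ν EB := hpos EB fun V => ind01 _ V
  have hZ0 : 0 ≤ mass ν := mass_nonneg hν0
  -- combine
  rcases hZ0.eq_or_lt with hZ | hZ
  · have hxy : μ (x ∪ y) = 0 := by
      have h1 : ν (x ∪ y) ≤ mass ν := le_mass hν0 _
      rw [hνapp, if_pos ⟨Finset.inter_subset_left.trans Finset.subset_union_left, subset_refl _⟩, ← hZ] at h1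
      exact le_antisymm h1 (h0 _)
    rw [hxy, zero_mul]
    exact mul_nonneg (h0 _) (h0 _)
  · have key : μ (x ∪ y) * μ K * (mass ν * mass ν) ≤ μ x * μ y * (mass ν * mass ν) :=
      calc μ (x ∪ y) * μ K * (mass ν * mass ν) = (μ (x ∪ y) * mass ν) * (μ K * mass ν) := by ring
        _ ≤ (ex ν H * ex ν U) * (ex ν EA * ex ν EB) :=
            mul_le_mul i1 i4 (mul_nonneg (h0 _) hZ0) (mul_nonneg hH0 hU0)
        _ = (ex ν H * ex ν EB) * (ex ν EA * ex ν U) := by ring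
        _ ≤ (μ x * mass ν) * (μ y * mass ν) :=
            mul_le_mul i2 i3 (mul_nonneg hEA0 hU0) (mul_nonneg (h0 _) hZ0)
        _ = μ x * μ y * (mass ν * mass ν) := by ring
    exact le_of_mul_le_mul_right key (mul_pos hZ hZ)

end NLC

/-! ## §3 CNA ⟹ h-NLC -/

section HNLC

/-- CNA is closed under conditioning. [cite: Pemantle2000, §2.2 Def. 2.2; BorceaBrandenLiggett2007, §2.1
Def. 2.7] -/
theorem IsCNA.pin {μ : Finset σ → ℝ} (h : IsCNA μ) (I O : Finset σ) : IsCNA (pin I O μ) := fun I' O' => by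
  rw [pin_pin]
  exact h _ _

/-- **CNA is closed under projections** ("any natural negative dependence property is closed under
projection"): conditioning on retained coordinates commutes with projecting, and NA passes to projections.
[cite: Pemantle2000, §2.1 (1. Projection), §2.2; BorceaBrandenLiggett2007, §2.1] -/
theorem IsCNA.projectOn {ν : Finset σ → ℝ} (h : IsCNA ν) (S : Finset σ) : IsCNA (projectOn S ν) := by
  intro I O
  rw [pin_projectOn]
  split_ifs with hIS
  · exact isNegAssoc_projectOn (h I (O ∩ S)) S
  · exact isNegAssoc_zero

/-- **CNA ⟹ h-NLC** (Pemantle §2.2; BBL Remark 2.4). [cite: Pemantle2000, §2.2 (CNA ⟹ JNRD ⟹ h-NLC);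
BorceaBrandenLiggett2007, §2.1 Remark 2.4] -/
theorem IsCNA.isHNLC {μ : Finset σ → ℝ} (hμ : IsCNA μ) (h0 : ∀ S, 0 ≤ μ S) : IsHNLC μ :=
  fun S => (hμ.projectOn S).isNLC (projectOn_nonneg h0 S)

/-- **Borcea–Brändén–Liggett, Remark 2.4** ("As explained in [P] […] CNA ⟹ h-NLC and CNA+ ⟹ Rayleigh/h-NLC+"),
for nonnegative weights. [cite: BorceaBrandenLiggett2007, §2.1 Remark 2.4; Pemantle2000, §2.2] -/
theorem BorceaBrandenLiggett_remark_2_4 {μ : Finset σ → ℝ} (h0 : ∀ S, 0 ≤ μ S) :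
    (IsCNA μ → IsHNLC μ) ∧ (IsCNAPlus μ → IsRayleigh μ ∧ IsHNLCPlus μ) :=
  ⟨fun h => h.isHNLC h0, fun h => ⟨h.isRayleigh, h.isHNLCPlus h0⟩⟩

end HNLC

end Literature.Probability.NegativeDependence

end
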